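import Summits.ResolutionOfSingularities.ResolutionOfSingularities.Theorems.FrobeniusLadderFRationalResolutionCoarseningEtale
import Literature.AlgebraicGeometry.Resolution.TameQuotientSingularitiesResolutionProofs
import Literature.AlgebraicGeometry.Resolution.FormalFibresInseparable
import Mathlib.LinearAlgebra.DFinsupp
import HarnessLib

/-!
# Crux `FrobeniusLadder.FRationalResolution` (stmt-ResolutionOfSingularities-15317), line `redirect`,
# stub `stub_diagonalizableQuotientResolution` — item (F2) of MEMO-15317-leafhand2-g20 §3 (NON-FIXED chart points,
# WILD case), ring level: the SUB-CHART `S^{(C)} = ⊕_{a ∈ C} S_a` of a subgroup `C ≤ A`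

For the quotient chart `Spec S₀ → X` of the stub (`S` regular of finite type, graded by the finite abelian group
`A`) and a point `𝔔` with unit-degree subgroup `B = B_𝔔` (`…StabilizerSubgroup`), the tame re-charting
`…FixedChart.exists_fixed_chart` needs `|A| ∈ k^×`. This file is the characteristic-free SPLIT-OFF step: for ANY
subgroup `C ≤ A` the degree-zero part `S^{(C)}` of the grading coarsened along `A → A/C` (`…Coarsening`) is

* `exists_kernelGrading` — graded by `C = ker (A → A/C)` with pieces `S_c` (`c ∈ C`) — an honest `GradedAlgebra`
  structure on the ring `S^{(C)}`, degree-zero part `S₀`: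
* `exists_ringEquiv_gradeZero` — `S₀ ≃+* (S^{(C)})₀` compatibly with the inclusions into `S`;
* `isRegularRing_gradeZero_of_units` — **`S^{(C)}` is REGULAR** when `S` is regular (Noetherian base, torsion
  `A/C`) and every class of `A/C` carries a homogeneous UNIT of `S`: then `S` is free over `S^{(C)}` on units
  (`…UnitBasisEtale.GradedUnits.free`), hence faithfully flat, and regularity descends (Stacks 07NG,
  `Literature…isRegularRing_of_faithfullyFlat`) — the `D(A/C)`-torsor `Spec S → Spec S^{(C)}` may be INSEPARABLE
  (`p ∣ [A : C]`), no tameness is used;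
* `finiteType_gradeZero` — `S^{(C)}` is of finite type;
* `mem_of_mem_kernelGrading_of_disjoint` — if `B ⊓ C = ⊥` the prime `𝔔 ∩ S^{(C)}` is FIXED for the `C`-grading
  (`(S^{(C)})_c ⊆ 𝔔` for `c ≠ 0`), and `comap_kernelGrading_zero` — it lies over the same point of `Spec S₀`.

So whenever `B_𝔔` admits a complement `C` (`B + C = A`, `B ∩ C = 0`; e.g. `A` elementary abelian, every wild
`(ℤ/p)^r`-quotient) the point re-charts to a FIXED point of the regular `C`-graded chart `S^{(C)}` with the SAME
quotient `S₀` — the input of the fixed-point files (`…FixedPointCompletionChart`, `…FixedPointResolution*`). The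
scheme-level packaging under the stub's `hq` is `…FixedChartOfSummand`. Honest label: helper toward ONE leaf stub;
no stub, crux or summit closed. No definitions, no named facts, no sorry.
[folklore; cite: SGA3, Exp. VIII §4–5] [cite: StacksProject, Tag 07NG]
-/

noncomputable section

-- single-problem summit: the doubled namespace component is forced
set_option linter.dupNamespace false

open DirectSum
open Literature.AlgebraicGeometry.Resolution
open Literature.AlgebraicGeometry.Resolution.DiagonalizableQuotient

namespace Summit.ResolutionOfSingularities.ResolutionOfSingularities.Theorems.FRationalResolution.SummandChart

universe u v w w'

variable {k : Type u} [CommRing k] {A : Type w} [DecidableEq A] [AddCommGroup A] {S : Type v}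
  [CommRing S] [Algebra k S] (𝒮 : A → Submodule k S) [GradedAlgebra 𝒮]
  {A' : Type w'} [DecidableEq A'] [AddCommGroup A'] (f : A →+ A')
  (𝒮' : A' → Submodule k S) [GradedAlgebra 𝒮']
  (h𝒮' : ∀ c, 𝒮' c = ⨆ a ∈ {a : A | f a = c}, 𝒮 a)

/-! ### The `ker f`-grading of the degree-zero part of a coarsening -/

include h𝒮' in
/-- **The sub-chart ring `S^{(C)} = (S')_0` is graded by `C = ker f` with pieces `S_c`.** For the grading `𝒮'`
coarsened along `f : A → A'` (`S'_c = ⨆_{f a = c} S_a`), its degree-zero part carries a `GradedAlgebra`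
structure over `ker f` whose piece of degree `c` consists of the elements of `S_c` (existential package).
[folklore; cite: SGA3, Exp. VIII §4–5] -/
theorem exists_kernelGrading [DecidableEq f.ker] :
    ∃ (𝒯 : f.ker → Submodule k (𝒮' 0)) (_ : GradedAlgebra 𝒯),
      ∀ (c : f.ker) (x : 𝒮' 0), x ∈ 𝒯 c ↔ (x : S) ∈ 𝒮 (c : A) := by
  classical
  let 𝒯 : f.ker → Submodule k (𝒮' 0) := fun c => (𝒮 (c : A)).comap (𝒮' 0).subtype
  have h𝒯 : ∀ (c : f.ker) (x : 𝒮' 0), x ∈ 𝒯 c ↔ (x : S) ∈ 𝒮 (c : A) := fun c x => Iff.rfl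
  -- graded monoid
  haveI hmon : SetLike.GradedMonoid 𝒯 :=
    { one_mem := by
        rw [h𝒯, AddSubgroup.coe_zero, SetLike.GradeZero.coe_one]
        exact SetLike.one_mem_graded 𝒮
      mul_mem := by
        intro c c' x y hx hy
        rw [h𝒯] at hx hy ⊢
        rw [AddSubgroup.coe_add, SetLike.GradeZero.coe_mul]
        exact SetLike.mul_mem_graded hx hy }
  -- independence: push a relation down to `S`
  have hindep : iSupIndep 𝒯 := by
    rw [iSupIndep_iff_finsetSum_eq_zero_imp_eq_zero]
    intro s v hv hsum i hi
    let v' : A → S := fun a => if h : a ∈ f.ker then ((v ⟨a, h⟩ : 𝒮' 0) : S) else 0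
    have hv' : ∀ c : f.ker, v' (c : A) = ((v c : 𝒮' 0) : S) := fun c => by
      simp only [v', dif_pos c.2]
    let emb : f.ker ↪ A := ⟨fun c => (c : A), Subtype.coe_injective⟩
    have hmem : ∀ a ∈ s.map emb, v' a ∈ 𝒮 a := by
      intro a ha
      obtain ⟨c, hc, rfl⟩ := Finset.mem_map.1 ha
      show v' (c : A) ∈ 𝒮 (c : A)
      rw [hv']
      exact (h𝒯 c _).1 (hv c hc)
    have hsum' : ∑ a ∈ s.map emb, v' a = 0 := by
      rw [Finset.sum_map]
      have h := congrArg (fun x : 𝒮' 0 => (x : S)) hsum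
      simp only [AddSubmonoidClass.coe_finsetSum, ZeroMemClass.coe_zero] at h
      rw [← h]
      exact Finset.sum_congr rfl fun c _ => hv' c
    have h0 := (iSupIndep_iff_finsetSum_eq_zero_imp_eq_zero 𝒮).1
      (Decomposition.isInternal 𝒮).submodule_iSupIndep (s.map emb) v' hmem hsum' (i : A)
      (Finset.mem_map_of_mem emb hi)
    rw [hv'] at h0
    exact Subtype.ext h0
  -- spanning: the homogeneous components of an element of `S'_0` have degrees in `ker f`
  have htop : ⨆ c, 𝒯 c = ⊤ := by
    rw [eq_top_iff]
    rintro x -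
    have hx0 : (x : S) ∈ ⨆ a ∈ {a : A | f a = 0}, 𝒮 a := by rw [← h𝒮' 0]; exact x.2
    have hzero : ∀ a : A, a ∉ f.ker → (decompose 𝒮 (x : S) a : S) = 0 := fun a ha =>
      Coarsening.decompose_apply_eq_zero_of_mem_biSup 𝒮 hx0 (fun h => ha h)
    -- lift the components into `S'_0`
    have hcomp0 : ∀ a : A, (decompose 𝒮 (x : S) a : S) ∈ 𝒮' 0 := by
      intro a
      by_cases ha : a ∈ f.ker
      · have hle : 𝒮 a ≤ 𝒮' 0 := CoarseningEtale.le_coarse_zero 𝒮 f 𝒮' h𝒮' ha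
        exact hle (SetLike.coe_mem _)
      · rw [hzero a ha]; exact zero_mem _
    have hxsum : x = ∑ a ∈ (decompose 𝒮 (x : S)).support, (⟨_, hcomp0 a⟩ : 𝒮' 0) := by
      apply Subtype.ext
      rw [AddSubmonoidClass.coe_finsetSum]
      exact (sum_support_decompose 𝒮 (x : S)).symm
    rw [hxsum]
    refine Submodule.sum_mem _ fun a _ => ?_
    by_cases ha : a ∈ f.ker
    · exact Submodule.mem_iSup_of_mem (⟨a, ha⟩ : f.ker) ((h𝒯 ⟨a, ha⟩ _).2 (SetLike.coe_mem _))
    · have h0 : (⟨_, hcomp0 a⟩ : 𝒮' 0) = 0 := Subtype.ext (hzero a ha)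
      rw [h0]; exact zero_mem _
  have hint : DirectSum.IsInternal 𝒯 :=
    (DirectSum.isInternal_submodule_iff_iSupIndep_and_iSup_eq_top _).2 ⟨hindep, htop⟩
  exact ⟨𝒯, { hmon with toDecomposition := hint.chooseDecomposition }, h𝒯⟩

/-! ### Properties of the sub-chart (pieces given by their description) -/

section Properties

variable (𝒯 : f.ker → Submodule k (𝒮' 0))
  (h𝒯 : ∀ (c : f.ker) (x : 𝒮' 0), x ∈ 𝒯 c ↔ (x : S) ∈ 𝒮 (c : A))

include h𝒮' h𝒯 in
omit [DecidableEq A] [GradedAlgebra 𝒮] in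
/-- **Same invariants**: `S_0 ≃+* (S^{(C)})_0` compatibly with the inclusions into `S`. [folklore] -/
theorem exists_ringEquiv_gradeZero [SetLike.GradedMonoid 𝒮] [SetLike.GradedMonoid 𝒯] :
    ∃ e : 𝒮 0 ≃+* 𝒯 0, ∀ x : 𝒮 0, ((e x : 𝒮' 0) : S) = (x : S) := by
  have hle : 𝒮 0 ≤ 𝒮' 0 := CoarseningEtale.le_coarse_zero 𝒮 f 𝒮' h𝒮' (zero_mem f.ker)
  have hto : ∀ x : 𝒮 0, (⟨(x : S), hle x.2⟩ : 𝒮' 0) ∈ 𝒯 0 := fun x => by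
    rw [h𝒯, AddSubgroup.coe_zero]; exact x.2
  have hfrom : ∀ y : 𝒯 0, ((y : 𝒮' 0) : S) ∈ 𝒮 0 := fun y => by
    have h := (h𝒯 0 _).1 y.2
    rwa [AddSubgroup.coe_zero] at h
  refine ⟨{ toFun := fun x => ⟨⟨(x : S), hle x.2⟩, hto x⟩
            invFun := fun y => ⟨((y : 𝒮' 0) : S), hfrom y⟩
            left_inv := fun x => Subtype.ext rfl
            right_inv := fun y => Subtype.ext (Subtype.ext rfl)
            map_mul' := fun x y => Subtype.ext (Subtype.ext rfl)
            map_add' := fun x y => Subtype.ext (Subtype.ext rfl) }, fun x => rfl⟩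

include h𝒮' in
omit [DecidableEq A] [GradedAlgebra 𝒮] in
/-- **`S^{(C)}` is of finite type** over a Noetherian base when `S` is and `A'` is torsion (Artin–Tate;
`DiagonalizableQuotient.finiteType_gradeZero`). [folklore] -/
theorem finiteType_gradeZero [IsNoetherianRing k] [Algebra.FiniteType k S] (hA' : AddMonoid.IsTorsion A') :
    Algebra.FiniteType k (𝒮' 0) := by
  have _ := h𝒮'
  exact DiagonalizableQuotient.finiteType_gradeZero 𝒮' hA'

/-- **`S^{(C)}` is REGULAR** when `S` is regular, of finite type over a Noetherian base, `A'` is torsion and every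
degree `c ∈ A'` carries a homogeneous UNIT of `S`: `S` is free over `S'_0` on units, hence faithfully flat, and
regularity descends along faithfully flat maps (the torsor `Spec S → Spec S^{(C)}` may be inseparable).
[cite: StacksProject, Tag 07NG] [folklore; cite: SGA3, Exp. VIII §4–5] -/
theorem isRegularRing_gradeZero_of_units [IsNoetherianRing k] [Algebra.FiniteType k S] [Nontrivial S]
    [IsRegularRing S] (hA' : AddMonoid.IsTorsion A') (hunits : ∀ c : A', ∃ u ∈ 𝒮' c, IsUnit u) :
    IsRegularRing (𝒮' 0) := by
  haveI : IsNoetherianRing (𝒮' 0) := DiagonalizableQuotient.isNoetherianRing_gradeZero 𝒮' hA'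
  haveI : Module.Free (𝒮' 0) S := UnitBasisEtale.GradedUnits.free 𝒮' hunits
  haveI : Module.FaithfullyFlat (𝒮' 0) S := inferInstance
  exact isRegularRing_of_faithfullyFlat (𝒮' 0) S

include h𝒯 in
omit [DecidableEq A] [GradedAlgebra 𝒮] in
/-- **The point is FIXED for the sub-chart when `B ⊓ C = ⊥`.** If the degrees of `S` carrying an element
outside the prime `𝔔` form the subgroup `B` and `B ⊓ ker f = ⊥`, then every piece `(S^{(C)})_c`, `c ≠ 0`, lies in
`𝔔 ∩ S^{(C)}`. [folklore; cite: SGA3, Exp. VIII §4–5] -/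
theorem mem_of_mem_kernelGrading_of_disjoint (𝔔 : Ideal S) (B : AddSubgroup A)
    (hB : ∀ a : A, a ∈ B ↔ ∃ s ∈ 𝒮 a, s ∉ 𝔔) (hBC : B ⊓ f.ker = ⊥)
    (c : f.ker) (hc : c ≠ 0) (x : 𝒮' 0) (hx : x ∈ 𝒯 c) :
    x ∈ 𝔔.comap (algebraMap (𝒮' 0) S) := by
  rw [Ideal.mem_comap]
  change (x : S) ∈ 𝔔
  have hcB : (c : A) ∉ B := by
    intro hcB
    have h : (c : A) ∈ B ⊓ f.ker := ⟨hcB, c.2⟩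
    rw [hBC, AddSubgroup.mem_bot] at h
    exact hc (Subtype.ext h)
  by_contra hxQ
  exact hcB ((hB (c : A)).2 ⟨(x : S), (h𝒯 c x).1 hx, hxQ⟩)

include h𝒮' h𝒯 in
omit [DecidableEq A] [GradedAlgebra 𝒮] in
/-- **Same point of the quotient.** For an ideal `𝔔` of `S`, the contraction of `𝔔 ∩ S^{(C)}` to `(S^{(C)})_0`
corresponds under `exists_ringEquiv_gradeZero` to the contraction of `𝔔` to `S_0`. [folklore] -/
theorem comap_kernelGrading_zero [SetLike.GradedMonoid 𝒮] [SetLike.GradedMonoid 𝒯] (𝔔 : Ideal S)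
    (e : 𝒮 0 ≃+* 𝒯 0) (he : ∀ x : 𝒮 0, ((e x : 𝒮' 0) : S) = (x : S)) :
    ((𝔔.comap (algebraMap (𝒮' 0) S)).comap (algebraMap (𝒯 0) (𝒮' 0))).comap e.toRingHom =
      𝔔.comap (algebraMap (𝒮 0) S) := by
  have _ := h𝒮'
  have _ := h𝒯
  ext x
  simp only [Ideal.mem_comap, RingEquiv.toRingHom_eq_coe, RingHom.coe_coe]
  change ((e x : 𝒮' 0) : S) ∈ 𝔔 ↔ (x : S) ∈ 𝔔
  rw [he]

end Properties

/-! ### Units in every class from units in the degrees of `B` with `B + C = A` -/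

include h𝒮' in
omit [DecidableEq A] [GradedAlgebra 𝒮] [DecidableEq A'] [GradedAlgebra 𝒮'] in
/-- If every `b ∈ B` carries a homogeneous unit of `S` and `B ⊔ ker f = ⊤`, then every degree `c ∈ A'` in the
image of `f` carries a homogeneous unit for the coarsened grading; in particular every `c` when `f` is onto.
[folklore] -/
theorem exists_unit_coarse_of_sup_eq_top (B : AddSubgroup A) (hBu : ∀ b ∈ B, ∃ u ∈ 𝒮 b, IsUnit u)
    (hBC : B ⊔ f.ker = ⊤) (hf : Function.Surjective f) (c : A') : ∃ u ∈ 𝒮' c, IsUnit u := by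
  obtain ⟨a, rfl⟩ := hf c
  have ha : a ∈ B ⊔ f.ker := by rw [hBC]; exact AddSubgroup.mem_top a
  obtain ⟨b, hb, z, hz, rfl⟩ := AddSubgroup.mem_sup.1 ha
  obtain ⟨u, hu, hunit⟩ := hBu b hb
  refine ⟨u, ?_, hunit⟩
  have hfb : f b = f (b + z) := by rw [map_add, show f z = 0 from hz, add_zero]
  have hle : 𝒮 b ≤ 𝒮' (f (b + z)) := by
    rw [← hfb]; exact CoarseningEtale.le_coarse 𝒮 f 𝒮' h𝒮' b
  exact hle hu

end Summit.ResolutionOfSingularities.ResolutionOfSingularities.Theorems.FRationalResolution.SummandChart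

end
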